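import Literature.NumberTheory.EllipticCurves.BSDConductorOggSaitoProofs
import HarnessLib

/-!
# `N^{(ℓ)}(V_ℓ E) = N_E` for an elliptic curve over `ℚ` (C15, corrected form): reduction to the
# Ogg–Saito leaves, and the unconditional cases

`Proofs` file (theorems only, no definitions, no named facts) in topic
`NumberTheory/EllipticCurves`, sibling of `HasseWeilAbelian`, serving its named fact

* `WeierstrassCurve.conductorNatOf_geomPoints_eq_conductorNorm_of_isElliptic W ℓ` — for an elliptic
  curve `E/ℚ` (`W` elliptic), a prime `ℓ ∤ N_E = W.conductorNorm ℤ` and every continuity witness `h`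
  of the Galois action on `V_ℓ E`, the numerical prime-to-`ℓ` Artin conductor
  `conductorNatOf (geomPoints W) ℓ h = N(∏_{p ≠ ℓ} p^{a_p(V_ℓ E)})` equals `N_E = ∏_p p^{f_p(E)}`
  (Serre–Tate 1968, §2.1 and §3: the exponent of the conductor of `V_ℓ A` at `v ∤ ℓ` is `ε + δ`;
  Silverman, *ATAEC*, §IV.10, Definition of `f = ε + δ` (PDF p. 358 of the held copy) and of
  `𝔣(E/K)`, `N_{E/ℚ}` (p. 364); §IV.11, Ogg's formula 11.1 (p. 365)).

By unique factorisation this fact is, for `ℓ ∤ N_E`, the exponentwise Ogg–Saito statement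
`a_p(V_ℓ E) = f_p(E)` at every `p ≠ ℓ` (with `f_p` *defined* by Ogg's formula
`ord_p Δ_min + 1 - m_p` in `Literature.NumberTheory.DiophantineGeometry.Conductor`, and `a_p` the
genuine `codim V^{I} + Swan` of `Literature.NumberTheory.GaloisRepresentations.ArtinConductor`).
The tree has reduced that statement (`WeierstrassCurve.artinConductorExponent_tate_eq_conductorExponent_of_isElliptic`)
to the single leaf `WeierstrassCurve.swanConductorAt_rationalTate_eq_wildConductorExponent_of_ringChar_eq W ℓ`
(Ogg's formula for the wild part at the additive places of residue characteristic `2, 3`;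
`InertiaInvariantsAdditiveProofs`), itself the conjunction of
`…_of_ringChar_eq_two W ℓ` (Saito 1988, Thm. 1) and `…_of_ringChar_eq_three W ℓ` (Ogg 1967;
*ATAEC* pp. 366–371) (`HasseWeilAbelianConductorOggSaito`); every other ingredient of Silverman's
Chapter IV route (Tate's algorithm, Kodaira–Néron over `K^nr`, Thm. IV.10.2(a),(b),
Néron–Ogg–Shafarevich, the good places, the bridge `W.conductorNorm (𝓞 ℚ) = W.conductorNorm ℤ`)
is a theorem of the tree.  This file records, for the C15 form of the fact (the bsd.S15 form
`Literature.NumberTheory.EllipticCurves.conductorNorm_eq_artinConductorNat_of_isElliptic W ℓ` being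
treated in `BSDConductorOggSaitoProofs`):

* `conductorNatOf_geomPoints_eq_conductorNorm_of_isElliptic_iff_conductorNorm_eq_artinConductorNat_of_isElliptic`
  — the C15 fact and the bsd.S15 fact are the same statement read in the two directions, so a
  discharge of either is a discharge of both;
* `…_of_isElliptic_of_ringChar_eq`, `…_of_isElliptic_of_two_of_three` — the fact from the leaf,
  resp. from its two halves: **the shape of the eventual discharge**
  `conductorNatOf_geomPoints_eq_conductorNorm_of_isElliptic_holds`, a one-liner once
  `…_of_ringChar_eq_two_holds` and `…_of_ringChar_eq_three_holds` exist;
* `…_of_isElliptic_of_three_of_not_hasAdditiveReductionAt_two` — from Ogg's `p = 3` half alone for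
  a curve with good or multiplicative reduction at `2`;
* **unconditional cases**: `…_of_isElliptic_of_not_hasAdditiveReductionAt_two_three` (every
  elliptic curve over `ℚ` with good or multiplicative reduction at `2` and at `3`; Silverman
  *ATAEC* Thm. IV.10.2(b): `δ = 0` unless additive reduction in residue characteristic `2, 3`) and
  `…_of_isElliptic_of_isSemistable` (every semistable elliptic curve over `ℚ`; *ATAEC*
  Example 10.5, PDF p. 364).

## What is deliberately not here

No proof of either leaf (Ogg's `p = 3` case analysis, Saito's `p = 2` theorem): they are named
facts of `HasseWeilAbelianConductorOggSaito` with their own seats.  No definitions, no new named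
facts (D-0026).

## References

* J.-P. Serre, J. Tate, *Good reduction of abelian varieties*, Ann. of Math. 88 (1968), §2.1, §3.
  [SerreTate1968]
* J. H. Silverman, *Advanced Topics in the Arithmetic of Elliptic Curves*, GTM 151 (1994), §IV.10
  (Definition p. 358, Thm. 10.2, Definition of `𝔣(E/K)` p. 364, Example 10.5), §IV.11 (Ogg's
  formula 11.1, p. 365, and its proof, pp. 366–371). [SilvermanATAEC1994]
* A. P. Ogg, *Elliptic curves and wild ramification*, Amer. J. Math. 89 (1967). [OggAJM1967]
* T. Saito, *Conductor, discriminant, and the Noether formula of arithmetic surfaces*, Duke Math.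
  J. 57 (1988), Theorem 1. [Saito1988]

## Design

No definitions; one-line assemblies of theorems of the tree (`BSDConductorProofs`,
`InertiaInvariantsAdditiveProofs`, `InertiaInvariantsMultiplicativeProofs`,
`BSDConductorOggSaitoProofs`); `noncomputable section`; the theorems are dot-notation extensions
of Mathlib's `WeierstrassCurve` namespace, deliberately, like the fact they serve.  All axioms
`propext`, `Classical.choice`, `Quot.sound`.
-/

noncomputable section

open scoped Classical NumberField
open NumberField IsDedekindDomain Field

namespace WeierstrassCurve

open Literature.NumberTheory.EllipticCurves Literature.NumberTheory.GaloisRepresentations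

variable (W : WeierstrassCurve ℚ) (ℓ : ℕ) [Fact ℓ.Prime]

/-- **The C15 fact and the bsd.S15 fact are one statement.**  For every `W / ℚ` and prime `ℓ`,
`conductorNatOf_geomPoints_eq_conductorNorm_of_isElliptic W ℓ` (`N^{(ℓ)}(V_ℓ E) = N_E` for elliptic
`W` and `ℓ ∤ N_E`, `HasseWeilAbelian`) is equivalent to
`conductorNorm_eq_artinConductorNat_of_isElliptic W ℓ` (`N_E = N^{(ℓ)}(V_ℓ E)`, `BSDConductor`):
same binders, conclusion read in the other direction. [folklore] -/
theorem conductorNatOf_geomPoints_eq_conductorNorm_of_isElliptic_iff_conductorNorm_eq_artinConductorNat_of_isElliptic :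
    W.conductorNatOf_geomPoints_eq_conductorNorm_of_isElliptic ℓ ↔
      conductorNorm_eq_artinConductorNat_of_isElliptic W ℓ := by
  constructor
  · intro hC _ h hℓ
    exact (hC h hℓ).symm
  · intro hS _ h hℓ
    exact (hS h hℓ).symm

/-- **`N^{(ℓ)}(V_ℓ E) = N_E` from the Ogg–Saito leaf alone.**  For every `W / ℚ` and prime `ℓ`, the
corrected C15 fact `conductorNatOf_geomPoints_eq_conductorNorm_of_isElliptic W ℓ` follows from
Ogg's formula for the wild part of the conductor at the additive places of residue characteristic
`2, 3` (`swanConductorAt_rationalTate_eq_wildConductorExponent_of_ringChar_eq W ℓ`, Silverman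
*ATAEC* IV.11.1 at those places), by `conductorNatOf_geomPoints_eq_conductorNorm_of_isElliptic_of_tate`
(`BSDConductorProofs`: the assembly `∏_{p ≠ ℓ} p^{a_p} = ∏_p p^{f_p}` for `ℓ ∤ N_E`, Silverman
*ATAEC* §IV.10 Definition of the conductor, PDF p. 364) and
`artinConductorExponent_tate_eq_conductorExponent_of_isElliptic_of_ringChar_eq`
(`InertiaInvariantsAdditiveProofs`: Thm. IV.10.2(a),(b), Kodaira–Néron and Néron–Ogg–Shafarevich
are theorems of the tree).
[cite: SilvermanATAEC1994, §IV.10 Definition of the conductor (PDF p. 364) with Thm. IV.10.2 and IV.11.1 (pp. 358–371)] -/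
theorem conductorNatOf_geomPoints_eq_conductorNorm_of_isElliptic_of_ringChar_eq
    (hW23 : W.swanConductorAt_rationalTate_eq_wildConductorExponent_of_ringChar_eq ℓ) :
    W.conductorNatOf_geomPoints_eq_conductorNorm_of_isElliptic ℓ :=
  W.conductorNatOf_geomPoints_eq_conductorNorm_of_isElliptic_of_tate ℓ
    (W.artinConductorExponent_tate_eq_conductorExponent_of_isElliptic_of_ringChar_eq ℓ hW23)

/-- **`N^{(ℓ)}(V_ℓ E) = N_E` from Ogg's `p = 3` theorem and Saito's `p = 2` theorem** (the two
halves `…_of_ringChar_eq_two W ℓ`, Saito 1988 Thm. 1, and `…_of_ringChar_eq_three W ℓ`, Ogg 1967 /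
Silverman *ATAEC* pp. 366–371, of `HasseWeilAbelianConductorOggSaito`).  This is the shape of the
eventual discharge `conductorNatOf_geomPoints_eq_conductorNorm_of_isElliptic_holds`.
[cite: SilvermanATAEC1994, §IV.10 Definition of the conductor (PDF p. 364) with Thm. IV.10.2 and IV.11.1 (pp. 358–371)] -/
theorem conductorNatOf_geomPoints_eq_conductorNorm_of_isElliptic_of_two_of_three
    (h2 : W.swanConductorAt_rationalTate_eq_wildConductorExponent_of_ringChar_eq_two ℓ)
    (h3 : W.swanConductorAt_rationalTate_eq_wildConductorExponent_of_ringChar_eq_three ℓ) :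
    W.conductorNatOf_geomPoints_eq_conductorNorm_of_isElliptic ℓ :=
  W.conductorNatOf_geomPoints_eq_conductorNorm_of_isElliptic_of_tate ℓ
    (W.artinConductorExponent_tate_eq_conductorExponent_of_isElliptic_of_two_of_three ℓ h2 h3)

/-- **`N^{(ℓ)}(V_ℓ E) = N_E` from Ogg's `p = 3` theorem alone, for a curve over `ℚ` with good or
multiplicative reduction at `2`** (`v₂ = primesEquiv.symm 2` the place of `𝓞 ℚ` above `2`; there
Saito's half is vacuous).  The residue-characteristic hypothesis of
`artinConductorExponent_tate_eq_conductorExponent_of_isElliptic_of_three_of_forall_not_hasAdditiveReductionAt_two`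
is converted to the place `v₂` by `eq_primesEquiv_symm_of_ringChar_eq` (`BSDConductorOggSaitoProofs`).
[cite: SilvermanATAEC1994, §IV.10 Definition of the conductor (PDF p. 364) with Thm. IV.10.2 and IV.11.1, case p = 3 (pp. 358–371)] -/
theorem
    conductorNatOf_geomPoints_eq_conductorNorm_of_isElliptic_of_three_of_not_hasAdditiveReductionAt_two
    (h3 : W.swanConductorAt_rationalTate_eq_wildConductorExponent_of_ringChar_eq_three ℓ)
    (hna2 : ¬ W.HasAdditiveReductionAt
      ((Rat.HeightOneSpectrum.primesEquiv (R := 𝓞 ℚ)).symm ⟨2, Nat.prime_two⟩)) :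
    W.conductorNatOf_geomPoints_eq_conductorNorm_of_isElliptic ℓ := by
  refine W.conductorNatOf_geomPoints_eq_conductorNorm_of_isElliptic_of_tate ℓ
    (W.artinConductorExponent_tate_eq_conductorExponent_of_isElliptic_of_three_of_forall_not_hasAdditiveReductionAt_two
      ℓ h3 fun v hv ↦ ?_)
  rwa [eq_primesEquiv_symm_of_ringChar_eq v Nat.prime_two hv]

/-- **`N^{(ℓ)}(V_ℓ E) = N_E` for an elliptic curve over `ℚ` with good or multiplicative reduction at
`2` and at `3` — no hypothesis left.**  Let `v₂`, `v₃` be the places of `𝓞 ℚ` above `2` and `3`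
(`Rat.HeightOneSpectrum.primesEquiv`).  If `W / ℚ` does not have additive reduction at `v₂` nor at
`v₃` (its reduction elsewhere is arbitrary), then for every prime `ℓ` the corrected C15 fact
`conductorNatOf_geomPoints_eq_conductorNorm_of_isElliptic W ℓ` holds: for elliptic `W`, every
continuity proof `h` and every `ℓ ∤ N_E`, `conductorNatOf (geomPoints W) ℓ h = W.conductorNorm ℤ`.
Silverman *ATAEC* §IV.10: Definition of the conductor (PDF p. 364), Thm. IV.10.2(a) and (b) (*"If
`E/K` has good or multiplicative reduction, or if `p ≥ 5`, then `δ(E/K) = 0`"*, p. 358) — all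
theorems of the tree — cover every place of such a curve (bsd.S15 form:
`conductorNorm_eq_artinConductorNat_of_isElliptic_of_not_hasAdditiveReductionAt_two_three`,
`BSDConductorOggSaitoProofs`).
[cite: SilvermanATAEC1994, §IV.10 Definition of the conductor (PDF p. 364) with Thm. IV.10.2(a),(b) (pp. 358–362)] -/
theorem conductorNatOf_geomPoints_eq_conductorNorm_of_isElliptic_of_not_hasAdditiveReductionAt_two_three
    (h2 : ¬ W.HasAdditiveReductionAt
      ((Rat.HeightOneSpectrum.primesEquiv (R := 𝓞 ℚ)).symm ⟨2, Nat.prime_two⟩))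
    (h3 : ¬ W.HasAdditiveReductionAt
      ((Rat.HeightOneSpectrum.primesEquiv (R := 𝓞 ℚ)).symm ⟨3, Nat.prime_three⟩)) :
    W.conductorNatOf_geomPoints_eq_conductorNorm_of_isElliptic ℓ :=
  (W.conductorNatOf_geomPoints_eq_conductorNorm_of_isElliptic_iff_conductorNorm_eq_artinConductorNat_of_isElliptic
      ℓ).mpr
    (conductorNorm_eq_artinConductorNat_of_isElliptic_of_not_hasAdditiveReductionAt_two_three W ℓ h2 h3)

/-- **`N^{(ℓ)}(V_ℓ E) = N_E` for a semistable elliptic curve over `ℚ` — no hypothesis left**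
(Silverman *ATAEC* Example 10.5, PDF p. 364: `𝔣(E/K) = ∏_{𝔭 ∣ 𝒟} 𝔭`; Thm. IV.10.2(a),(b) at the
multiplicative places), by `artinConductorExponent_tate_eq_conductorExponent_of_isSemistable`
(`InertiaInvariantsMultiplicativeProofs`).
[cite: SilvermanATAEC1994, Thm. IV.10.2(a),(b) and Example 10.5 (PDF pp. 358–364)] -/
theorem conductorNatOf_geomPoints_eq_conductorNorm_of_isElliptic_of_isSemistable
    (hs : W.IsSemistable (𝓞 ℚ)) :
    W.conductorNatOf_geomPoints_eq_conductorNorm_of_isElliptic ℓ :=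
  W.conductorNatOf_geomPoints_eq_conductorNorm_of_isElliptic_of_tate ℓ
    (W.artinConductorExponent_tate_eq_conductorExponent_of_isSemistable ℓ hs)

end WeierstrassCurve

end
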